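import Summits.KontsevichZagierPeriods.KontsevichZagierPeriods.Theorems.SymplecticScissorsVolumeFormOffPlaneToricA
import Mathlib.Analysis.SpecialFunctions.Pow.Real

/-!
# Toric assembly, part H: arbitrary real-algebraic positions, edge ratios in `α^ℚ β^ℚ`

Helper file for the stub `stub_toricAssembly` of the line `Sketch` (card `log-polytope-hilbert-three`)
of the crux `VolumeFormOffPlane` (stmt-KontsevichZagierPeriods-14935), route `SymplecticScissors`.

The class of a log-box in `FormalRep ⧸ relations` only depends on its EDGE RATIOS `b_j / a_j`
(one diagonal scaling by the positive real-algebraic vector `a⁻¹`, rule 2 — the packaged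
`toric_rescale` of part A). Hence the rational-exponent sector statement (conclusion of
`toric_rtb_rat`, part G; hypothesis `hRat` here) extends from corners `(α^u β^v, α^{u₁} β^{v₁})` to
log-boxes in ARBITRARY positive real-algebraic position `a_j` whose edge ratios lie in `α^ℚ β^ℚ`:
finite families of such boxes with equal total value are KZ-equivalent as formal sums — the
Λ-polytope form of the card's lever for boxes (`Λ ∋ log a_j`, rational directions `ℚ log α + ℚ log β`).
-/

noncomputable section

open MeasureTheory Set
open Literature.NumberTheory.Transcendental

namespace Summit.KontsevichZagierPeriods.SymplecticScissors.LogPolytope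

-- Shorthands used in the SOURCE of this file (work/toric/ToricH.src.lean, expanded by
-- work/toric/pp.py before checking/landing; the landed file is notation-free):
--   𝔅(n, a, b) = the log-box;  π = QuotientAddGroup.mk' KZ.relations;  HExists / HScale = the
--   registered statements (verbatim);  RTBQ = the conclusion of `toric_rtb_rat` (verbatim).

/-- **Sums of classes and sums of values are invariant under boxwise rescaling to origin boxes.**
For a family of log-boxes over `(a i, b i)` (positive real-algebraic corners) and a family of
integrand-`1` representations on the ORIGIN boxes with the same edge ratios `(1, b i j / a i j)`,
the formal sums have the same class and the same total value. [folklore] -/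
theorem toric_rescale_family : (∀ (n : ℕ) (a b : Fin n → ℝ), (∀ j, 0 < a j) → (∀ j, IsAlgebraic ℚ (a j)) → (∀ j, IsAlgebraic ℚ (b j)) → ∃ r : KZ.IntegralRep (n + 1), r.domain = {p : Fin (n + 1) → ℝ | (∀ j : Fin n, a j < p (Fin.castSucc j) ∧ p (Fin.castSucc j) < b j) ∧ 0 < p (Fin.last n) ∧ p (Fin.last n) * ∏ j : Fin n, p (Fin.castSucc j) < 1} ∧ r.integrand = fun _ => 1) → (∀ (n : ℕ) (a b l : Fin n → ℝ), (∀ j, 0 < l j) → (∀ j, IsAlgebraic ℚ (l j)) → ∀ (r r' : KZ.IntegralRep (n + 1)), r.domain = {p : Fin (n + 1) → ℝ | (∀ j : Fin n, a j < p (Fin.castSucc j) ∧ p (Fin.castSucc j) < b j) ∧ 0 < p (Fin.last n) ∧ p (Fin.last n) * ∏ j : Fin n, p (Fin.castSucc j) < 1} → r'.domain = {p : Fin (n + 1) → ℝ | (∀ j : Fin n, l j * a j < p (Fin.castSucc j) ∧ p (Fin.castSucc j) < l j * b j) ∧ 0 < p (Fin.last n) ∧ p (Fin.last n) * ∏ j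 : Fin n, p (Fin.castSucc j) < 1} → (∀ p ∈ r.domain, r.integrand p = 1) → (∀ p ∈ r'.domain, r'.integrand p = 1) → KZ.of r - KZ.of r' ∈ KZ.relations) → ∀ {n k : ℕ} (a b : Fin k → Fin n → ℝ) (r o : Fin k → KZ.IntegralRep (n + 1)), (∀ i j, 0 < a i j) → (∀ i j, IsAlgebraic ℚ (a i j)) → (∀ i j, IsAlgebraic ℚ (b i j)) → (∀ i, (r i).domain = {ξ : Fin (n + 1) → ℝ | (∀ ι : Fin n, (fun j => a i j) ι < ξ (Fin.castSucc ι) ∧ ξ (Fin.castSucc ι) < (fun j => b i j) ι) ∧ 0 < ξ (Fin.last n) ∧ ξ (Fin.last n) * ∏ ι : Fin n, ξ (Fin.castSucc ι) < 1}) → (∀ i, ∀ x ∈ (r i).domain, (r i).integrand x = 1) → (∀ i, (o i).domain = {ξ : Fin (n + 1) → ℝ | (∀ ι : Fin n, (fun _ => (1:ℝ)) ι < ξ (Fin.castSucc ι) ∧ ξ (Fin.castSucc ι) < (fun j => (a i j)⁻¹ * b i j) ι) ∧ 0 < ξ (Fin.last n) ∧ ξ (Fin.last n) * ∏ ι : Fin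 n, ξ (Fin.castSucc ι) < 1}) → (∀ i, ∀ x ∈ (o i).domain, (o i).integrand x = 1) → (∑ i, KZ.of (r i) - ∑ i, KZ.of (o i) ∈ KZ.relations) ∧ ∑ i, (r i).value = ∑ i, (o i).value := by
  intro hEx hScale n k a b r o ha haa hba hrd hr hod ho
  have hi : ∀ i, (QuotientAddGroup.mk' KZ.relations) (KZ.of (r i)) = (QuotientAddGroup.mk' KZ.relations) (KZ.of (o i)) := by
    intro i
    exact toric_rescale hEx hScale (fun j => (a i j)⁻¹) (fun j => inv_pos.mpr (ha i j))
      (fun j => (haa i j).inv) (ha i) (haa i) (hba i) (r i) (hrd i) (hr i)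
      (fun j => inv_mul_cancel₀ (ha i j).ne') (fun j => rfl) (o i) (hod i) (ho i)
  have hrel : ∑ i, KZ.of (r i) - ∑ i, KZ.of (o i) ∈ KZ.relations := by
    refine toric_mk_eq_iff.mp ?_
    rw [map_sum, map_sum]
    exact Finset.sum_congr rfl fun i _ => hi i
  refine ⟨hrel, ?_⟩
  have h0 := KZ.relations_le_ker_eval_holds hrel
  rw [AddMonoidHom.mem_ker, map_sub, map_sum, map_sum, sub_eq_zero] at h0
  simpa only [KZ.eval_of] using h0

/-- **The rank-two toric box sector in arbitrary real-algebraic position.** Under the existence and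
scaling statements (registered conjuncts of `stub_logBoxCut`, `stub_logBoxLinear`) and the
rational-exponent sector (conclusion of `toric_rtb_rat`): finite families of log-boxes with
positive real-algebraic lower corners `a i j` and upper corners `a i j · α^{u} β^{v}` (`u, v ∈ ℚ`,
`α, β` multiplicatively independent positive real algebraic numbers, edges non-empty) and equal
total value are KZ-equivalent as formal sums, in every dimension `n + 1`. [folklore] -/
theorem toric_rtb_position (hEx : (∀ (n : ℕ) (a b : Fin n → ℝ), (∀ j, 0 < a j) → (∀ j, IsAlgebraic ℚ (a j)) → (∀ j, IsAlgebraic ℚ (b j)) → ∃ r : KZ.IntegralRep (n + 1), r.domain = {p : Fin (n + 1) → ℝ | (∀ j : Fin n, a j < p (Fin.castSucc j) ∧ p (Fin.castSucc j) < b j) ∧ 0 < p (Fin.last n) ∧ p (Fin.last n) * ∏ j : Fin n, p (Fin.castSucc j) < 1} ∧ r.integrand = fun _ => 1)) (hScale : (∀ (n : ℕ) (a b l : Fin n → ℝ), (∀ j, 0 < l j) → (∀ j, IsAlgebraic ℚ (l j)) → ∀ (r r' : KZ.IntegralRep (n + 1)), r.domain = {p : Fin (n + 1) → ℝ | (∀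 j : Fin n, a j < p (Fin.castSucc j) ∧ p (Fin.castSucc j) < b j) ∧ 0 < p (Fin.last n) ∧ p (Fin.last n) * ∏ j : Fin n, p (Fin.castSucc j) < 1} → r'.domain = {p : Fin (n + 1) → ℝ | (∀ j : Fin n, l j * a j < p (Fin.castSucc j) ∧ p (Fin.castSucc j) < l j * b j) ∧ 0 < p (Fin.last n) ∧ p (Fin.last n) * ∏ j : Fin n, p (Fin.castSucc j) < 1} → (∀ p ∈ r.domain, r.integrand p = 1) → (∀ p ∈ r'.domain, r'.integrand p = 1) → KZ.of r - KZ.of r' ∈ KZ.relations)) (hRat : (∀ (n : ℕ) (α β : ℝ), 0 < α → 0 < β → IsAlgebraic ℚ α → IsAlgebraic ℚ β → (∀ p q : ℤ, α ^ p * β ^ q = 1 → p = 0 ∧ q = 0) → ∀ (k k' : ℕ) (u v u₁ v₁ : Fin k → Fin n → ℚ) (s t s₁ t₁ : Fin k' → Fin n → ℚ) (r : Fin k → KZ.IntegralRep (n + 1)) (r' : Fin k' → KZ.IntegralRep (n + 1)), (∀ i j, α ^ ((u i j : ℚ) : ℝ) * β ^ ((v i j : ℚ) : ℝ) < α ^ ((u₁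 i j : ℚ) : ℝ) * β ^ ((v₁ i j : ℚ) : ℝ)) → (∀ i j, α ^ ((s i j : ℚ) : ℝ) * β ^ ((t i j : ℚ) : ℝ) < α ^ ((s₁ i j : ℚ) : ℝ) * β ^ ((t₁ i j : ℚ) : ℝ)) → (∀ i, (r i).domain = {p : Fin (n + 1) → ℝ | (∀ j : Fin n, α ^ ((u i j : ℚ) : ℝ) * β ^ ((v i j : ℚ) : ℝ) < p (Fin.castSucc j) ∧ p (Fin.castSucc j) < α ^ ((u₁ i j : ℚ) : ℝ) * β ^ ((v₁ i j : ℚ) : ℝ)) ∧ 0 < p (Fin.last n) ∧ p (Fin.last n) * ∏ j : Fin n, p (Fin.castSucc j) < 1}) → (∀ i, ∀ p ∈ (r i).domain, (r i).integrand p = 1) → (∀ i, (r' i).domain = {p : Fin (n + 1) → ℝ | (∀ j : Fin n, α ^ ((s i j : ℚ) : ℝ) * β ^ ((t i j : ℚ) : ℝ) < p (Fin.castSucc j) ∧ p (Fin.castSucc j) < α ^ ((s₁ i j : ℚ) : ℝ) * β ^ ((t₁ i j : ℚ) : ℝ)) ∧ 0 < p (Fin.last n) ∧ p (Fin.last n)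 * ∏ j : Fin n, p (Fin.castSucc j) < 1}) → (∀ i, ∀ p ∈ (r' i).domain, (r' i).integrand p = 1) → ∑ i, (r i).value = ∑ i, (r' i).value → ∑ i, KZ.of (r i) - ∑ i, KZ.of (r' i) ∈ KZ.relations)) : ∀ (n : ℕ) (α β : ℝ), 0 < α → 0 < β → IsAlgebraic ℚ α → IsAlgebraic ℚ β → (∀ p q : ℤ, α ^ p * β ^ q = 1 → p = 0 ∧ q = 0) → ∀ (k k' : ℕ) (a : Fin k → Fin n → ℝ) (u v : Fin k → Fin n → ℚ) (a' : Fin k' → Fin n → ℝ) (s t : Fin k' → Fin n → ℚ) (r : Fin k → KZ.IntegralRep (n + 1)) (r' : Fin k' → KZ.IntegralRep (n + 1)), (∀ i j, 0 < a i j) → (∀ i j, IsAlgebraic ℚ (a i j)) → (∀ i j, 1 < α ^ ((u i j : ℚ) : ℝ) * β ^ ((v i j : ℚ) : ℝ)) → (∀ i j, 0 < a' i j) → (∀ i j, IsAlgebraic ℚ (a' i j)) → (∀ i j, 1 < α ^ ((s i j : ℚ) : ℝ) * β ^ ((t i j : ℚ) : ℝ)) → (∀ i, (r i).domain = {p : Fin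 (n + 1) → ℝ | (∀ j : Fin n, a i j < p (Fin.castSucc j) ∧ p (Fin.castSucc j) < a i j * (α ^ ((u i j : ℚ) : ℝ) * β ^ ((v i j : ℚ) : ℝ))) ∧ 0 < p (Fin.last n) ∧ p (Fin.last n) * ∏ j : Fin n, p (Fin.castSucc j) < 1}) → (∀ i, ∀ p ∈ (r i).domain, (r i).integrand p = 1) → (∀ i, (r' i).domain = {p : Fin (n + 1) → ℝ | (∀ j : Fin n, a' i j < p (Fin.castSucc j) ∧ p (Fin.castSucc j) < a' i j * (α ^ ((s i j : ℚ) : ℝ) * β ^ ((t i j : ℚ) : ℝ))) ∧ 0 < p (Fin.last n) ∧ p (Fin.last n) * ∏ j : Fin n, p (Fin.castSucc j) < 1}) → (∀ i, ∀ p ∈ (r' i).domain, (r' i).integrand p = 1) → ∑ i, (r i).value = ∑ i, (r' i).value → ∑ i, KZ.of (r i) - ∑ i, KZ.of (r' i) ∈ KZ.relations := by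
  intro n α β hα hβ hαa hβa hind k k' a u v a' s t r r' ha haa hlt ha' ha'a hlt' hrd hr hrd' hr' hv
  -- algebraicity of rational powers of positive algebraic numbers
  have hrpow : ∀ {x : ℝ}, 0 < x → IsAlgebraic ℚ x → ∀ q : ℚ, IsAlgebraic ℚ (x ^ ((q : ℚ) : ℝ)) := by
    intro x hx hxa q
    have hden : 0 < q.den := q.den_pos
    refine IsAlgebraic.of_pow hden ?_
    rw [← Real.rpow_natCast, ← Real.rpow_mul hx.le]
    have : ((q : ℚ) : ℝ) * (q.den : ℝ) = (q.num : ℝ) := by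
      have h := Rat.mul_den_eq_num q
      exact_mod_cast congrArg (fun z : ℚ => (z : ℝ)) h
    rw [this, Real.rpow_intCast]
    cases q.num with
    | ofNat m => simpa using hxa.pow m
    | negSucc m => rw [zpow_negSucc]; exact (hxa.pow (m + 1)).inv
  have hcor : ∀ (uu vv : ℚ), IsAlgebraic ℚ (α ^ ((uu : ℚ) : ℝ) * β ^ ((vv : ℚ) : ℝ)) :=
    fun uu vv => (hrpow hα hαa uu).mul (hrpow hβ hβa vv)
  -- origin families
  choose o hod hoi using fun i : Fin k => hEx n (fun _ => (1:ℝ))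
    (fun j => α ^ (((0 : ℚ) : ℚ) : ℝ) * β ^ (((0 : ℚ) : ℚ) : ℝ) * (α ^ ((u i j : ℚ) : ℝ) * β ^ ((v i j : ℚ) : ℝ)))
    (fun _ => one_pos) (fun _ => isAlgebraic_one) (fun j => (hcor 0 0).mul (hcor _ _))
  choose o' hod' hoi' using fun i : Fin k' => hEx n (fun _ => (1:ℝ))
    (fun j => α ^ (((0 : ℚ) : ℚ) : ℝ) * β ^ (((0 : ℚ) : ℚ) : ℝ) * (α ^ ((s i j : ℚ) : ℝ) * β ^ ((t i j : ℚ) : ℝ)))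
    (fun _ => one_pos) (fun _ => isAlgebraic_one) (fun j => (hcor 0 0).mul (hcor _ _))
  have ho : ∀ i, ∀ x ∈ (o i).domain, (o i).integrand x = 1 := fun i x _ => by rw [hoi i]
  have ho' : ∀ i, ∀ x ∈ (o' i).domain, (o' i).integrand x = 1 := fun i x _ => by rw [hoi' i]
  have h00 : α ^ (((0 : ℚ) : ℚ) : ℝ) * β ^ (((0 : ℚ) : ℚ) : ℝ) = 1 := by simp
  -- rescale both families to origin position
  obtain ⟨h₁, hv₁⟩ := toric_rescale_family hEx hScale a
    (fun i j => a i j * (α ^ ((u i j : ℚ) : ℝ) * β ^ ((v i j : ℚ) : ℝ))) r o ha haa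
    (fun i j => (haa i j).mul (hcor _ _)) hrd hr (fun i => by
      rw [hod i]; ext x
      simp only [mem_setOf_eq, h00, one_mul, inv_mul_cancel_left₀ (ha i _).ne']) ho
  obtain ⟨h₂, hv₂⟩ := toric_rescale_family hEx hScale a'
    (fun i j => a' i j * (α ^ ((s i j : ℚ) : ℝ) * β ^ ((t i j : ℚ) : ℝ))) r' o' ha' ha'a
    (fun i j => (ha'a i j).mul (hcor _ _)) hrd' hr' (fun i => by
      rw [hod' i]; ext x
      simp only [mem_setOf_eq, h00, one_mul, inv_mul_cancel_left₀ (ha' i _).ne']) ho'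
  -- the origin families are instances of the rational-exponent sector (lower exponents 0)
  have h₃ : ∑ i, KZ.of (o i) - ∑ i, KZ.of (o' i) ∈ KZ.relations := by
    refine hRat n α β hα hβ hαa hβa hind k k' (fun _ _ => 0) (fun _ _ => 0) u v
      (fun _ _ => 0) (fun _ _ => 0) s t o o' (fun i j => ?_) (fun i j => ?_) (fun i => ?_) ho
      (fun i => ?_) ho' (by rw [← hv₁, ← hv₂, hv])
    · simpa [h00] using hlt i j
    · simpa [h00] using hlt' i j
    · rw [hod i]; ext x; simp only [mem_setOf_eq, h00, one_mul]
    · rw [hod' i]; ext x; simp only [mem_setOf_eq, h00, one_mul]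
  have : ∑ i, KZ.of (r i) - ∑ i, KZ.of (r' i) = (∑ i, KZ.of (r i) - ∑ i, KZ.of (o i)) +
      (∑ i, KZ.of (o i) - ∑ i, KZ.of (o' i)) - (∑ i, KZ.of (r' i) - ∑ i, KZ.of (o' i)) := by abel
  rw [this]
  exact KZ.relations.sub_mem (KZ.relations.add_mem h₁ h₃) h₂

end Summit.KontsevichZagierPeriods.SymplecticScissors.LogPolytope

end
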